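import Summits.Parity.GeneralizedHardyLittlewood.Theorems.GreenTaoLevelTwoGITwoCyclicInverseBohrSize

/-!
# Route `GreenTaoLevelTwo`, crux `GITwo` (stmt-Parity-21275), line `birth`, stub `stub_cyclicInverse`:
# pigeonholing a finite set into one box of the torus `(ℝ/ℤ)^S` (for GT08a arXiv Lemma 44)

Twelfth helper file toward the XL stub `stub_cyclicInverse` (B. Green, T. Tao, arXiv:math/0503014,
Thm. 68 = PEMS 51 (2008) Thm. 12.8).  The linearisation step (arXiv Lemma 44: "cover the torus
`(ℝ/ℤ)^S` by `2^{6|S|}` cubes of side-length `1/64` … the pigeonhole principle implies that there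
exists one of these cubes `Q` for which `Γ'' := {(h, ξ_h) ∈ Γ' : Ψ(ξ_h) ∈ Q}` has
`|Γ''| ≥ 2^{-6|S|}|Γ'|`") and the Bohr-set size bound (arXiv Lemma 35, file `…BohrSize`) use the same
device.  This def-free file lands it once, generically: for any finite set `X`, any "frequency" map
`φ : X → ℤ/Nℤ`, any finite `S ⊆ ℤ/Nℤ` and any integer `L ≥ 1` there is `X' ⊆ X` with
`#X' ≥ #X / L^{#S}` whose elements pairwise satisfy `‖(φx − φx')·s/N‖_{ℝ/ℤ} < 1/L` for all `s ∈ S`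
(`exists_large_box_fiber`); in particular all differences `φx − φx'` lie in the Bohr set `B(S, 1/L)`.

References: [GreenTao2008U3Inverse] arXiv:math/0503014, proof of Lemma 44 (and Lemma 35).
-/

namespace Summit.Parity.GeneralizedHardyLittlewood.GreenTaoLevelTwoGITwoCyclicInverse

open Finset

variable {N : ℕ} [NeZero N]

/-- **One large torus box.** For a finite set `X`, a map `φ : X → ℤ/Nℤ`, a finite set of
frequencies `S` and an integer `L ≥ 1`, some `X' ⊆ X` with `#X' ≥ #X/L^{#S}` has all its elements
in a common box: `‖toAddCircle(φx·s) − toAddCircle(φx'·s)‖ < 1/L` for all `x, x' ∈ X'`, `s ∈ S`.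
[cite: GreenTao2008U3Inverse, Lemma 44 (proof: the pigeonhole over torus cubes)] -/
theorem exists_large_box_fiber {α : Type*} [DecidableEq α] (X : Finset α) (φ : α → ZMod N)
    (S : Finset (ZMod N)) {L : ℕ} (hL : 0 < L) :
    ∃ X' ⊆ X, (#X : ℝ) / (L : ℝ) ^ #S ≤ #X' ∧
      ∀ x ∈ X', ∀ x' ∈ X', ∀ s ∈ S,
        ‖ZMod.toAddCircle (φ x * s) - ZMod.toAddCircle (φ x' * s)‖ < 1 / (L : ℝ) := by
  classical
  have hN : 0 < N := Nat.pos_of_ne_zero (NeZero.ne N)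
  have hNr : (0 : ℝ) < N := by exact_mod_cast hN
  have hLr : (0 : ℝ) < L := by exact_mod_cast hL
  rcases X.eq_empty_or_nonempty with hX | hX
  · refine ⟨∅, by simp [hX], by simp [hX], by simp⟩
  have hbox : ∀ v : ZMod N, v.val * L / N < L := by
    intro v
    rw [Nat.div_lt_iff_lt_mul hN, mul_comm L]
    exact Nat.mul_lt_mul_of_pos_right (ZMod.val_lt v) hL
  let box : α → (↥S → Fin L) := fun x s => ⟨(φ x * (s : ZMod N)).val * L / N, hbox _⟩
  have hmaps : ∀ x ∈ X, box x ∈ (univ : Finset (↥S → Fin L)) := fun _ _ => mem_univ _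
  have ht : (univ : Finset (↥S → Fin L)).Nonempty := ⟨fun _ => ⟨0, hL⟩, mem_univ _⟩
  have hcardt : #(univ : Finset (↥S → Fin L)) = L ^ #S := by
    rw [card_univ, Fintype.card_fun, Fintype.card_fin, Fintype.card_coe]
  have hb : #(univ : Finset (↥S → Fin L)) • ((#X : ℝ) / (L : ℝ) ^ #S) ≤ #X := by
    rw [hcardt, nsmul_eq_mul]
    push_cast
    rw [mul_div_cancel₀ _ (by positivity)]
  obtain ⟨y, -, hy⟩ := exists_le_card_fiber_of_nsmul_le_card_of_maps_to hmaps ht hb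
  refine ⟨{x ∈ X | box x = y}, filter_subset _ X, hy, ?_⟩
  intro x hx x' hx' s hs
  rw [mem_filter] at hx hx'
  have hsame : (φ x * s).val * L / N = (φ x' * s).val * L / N := by
    have h3 : box x ⟨s, hs⟩ = box x' ⟨s, hs⟩ := by rw [hx.2, hx'.2]
    exact congrArg Fin.val h3
  have hlt := abs_sub_mul_lt_of_div_eq hsame
  refine (norm_toAddCircle_sub_le _ _).trans_lt ?_
  rw [div_lt_div_iff₀ hNr hLr, one_mul]
  exact hlt

/-- In particular all differences of frequencies from one box lie in the Bohr set `B(S, 1/L)`: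
`‖toAddCircle((φx − φx')·s)‖ < 1/L`. [cite: GreenTao2008U3Inverse, Lemma 44 (proof)] -/
theorem exists_large_box_fiber_sub (α : Type*) [DecidableEq α] (X : Finset α) (φ : α → ZMod N)
    (S : Finset (ZMod N)) {L : ℕ} (hL : 0 < L) :
    ∃ X' ⊆ X, (#X : ℝ) / (L : ℝ) ^ #S ≤ #X' ∧
      ∀ x ∈ X', ∀ x' ∈ X', ∀ s ∈ S,
        ‖ZMod.toAddCircle ((φ x - φ x') * s)‖ < 1 / (L : ℝ) := by
  obtain ⟨X', hX', hcard, hbox⟩ := exists_large_box_fiber X φ S hL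
  refine ⟨X', hX', hcard, fun x hx x' hx' s hs => ?_⟩
  rw [sub_mul, map_sub]
  exact hbox x hx x' hx' s hs

end Summit.Parity.GeneralizedHardyLittlewood.GreenTaoLevelTwoGITwoCyclicInverse
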